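import Literature.Topology.FourManifolds.WhiteheadBendMap
import Literature.Topology.FourManifolds.WhiteheadCells
import Literature.Analysis.Convexity.ComplexUnion
import Literature.Analysis.Convexity.StandardExtension
import Literature.Analysis.Convexity.CanonicalComplex
import HarnessLib

/-!
# Whitehead triangulations, the extension step (Munkres 10.4), part X1–X2: straight part and cells

After the bending step (`WhiteheadBend`, `WhiteheadBendMap`) the bent map `f'` is *straight*
(`e ∘ f'` simplexwise affine, equal to the secant map `Λ`) on the simplices of the trimmed complex
`K''` lying in the zone of `R₂`.  This file sets up the objects of the extension step in the chart
space `𝔼 n`: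

* Part X1 — the straight subcomplex `StrCx`, injectivity of `Λ` on it, its image complex `Q` in
  `𝔼 n` (`ComplexTransport.exists_simplicialComplex_image`); boxes; the top straight simplices
  `T₁` whose images meet the outer box `R₀⁺`, and the facts that every simplex of `K''` sharing a
  vertex with one of them is straight and that every straight simplex whose image meets `R₀⁺` is
  a face of one of them;
* Part X2 — the arrangement of the box-facet functionals of the inner box `R₀` and the barycentric
  functionals of the simplices `Λ(t)`, `t ∈ T₁`, and its cell complex `Ph` (`WhiteheadCells`):
  it covers `R₀ ∪ ⋃ Λ(t)`, each simplex lies in `R₀` or in a single `Λ(t)`, it refines every face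
  of every `Λ(t)` simplexwise, the vertices `Λ v` are vertices of `Ph`, and a simplex of `Ph` has
  at most one such vertex (`Ph_vertex_unique`).

No named facts are introduced.
-/

open Set Function Metric Filter
open scoped Topology NNReal Manifold

noncomputable section

-- `[T2Space M]` is a section variable used by most lemmas below; per-lemma `omit` would be noise.
set_option linter.unusedSectionVars false

namespace Literature.Topology.FourManifolds

open Literature.Analysis.Convexity Literature.Analysis.Convexity.SignArrangement

local notation "𝔼 " n:arg => EuclideanSpace ℝ (Fin n)

/-! ### Boxes in the chart space -/

section Box

variable {n : ℕ}

/-- The closed coordinate box `[a, b]` of `𝔼 n`. [folklore] -/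
def box (a b : Fin n → ℝ) : Set (𝔼 n) := {x | ∀ i, a i ≤ x i ∧ x i ≤ b i}

/-- The open coordinate box `(a, b)` of `𝔼 n`. [folklore] -/
def openBox (a b : Fin n → ℝ) : Set (𝔼 n) := {x | ∀ i, a i < x i ∧ x i < b i}

/-- Auxiliary (`mem_box_iff`). [folklore] -/
theorem mem_box_iff {a b : Fin n → ℝ} {x : 𝔼 n} : x ∈ box a b ↔ ∀ i, a i ≤ x i ∧ x i ≤ b i := Iff.rfl

/-- Auxiliary (`mem_openBox_iff`). [folklore] -/
theorem mem_openBox_iff {a b : Fin n → ℝ} {x : 𝔼 n} : x ∈ openBox a b ↔ ∀ i, a i < x i ∧ x i < b i :=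
  Iff.rfl

/-- The coordinate maps are continuous. [folklore] -/
theorem continuous_coord (i : Fin n) : Continuous fun x : 𝔼 n => x i :=
  (EuclideanSpace.proj i).continuous

/-- Closed boxes are closed. [folklore] -/
theorem isClosed_box (a b : Fin n → ℝ) : IsClosed (box a b) := by
  have : box a b = ⋂ i, {x : 𝔼 n | a i ≤ x i ∧ x i ≤ b i} := by ext x; simp [box]
  rw [this]
  exact isClosed_iInter fun i => (isClosed_le continuous_const (continuous_coord i)).inter
    (isClosed_le (continuous_coord i) continuous_const)

/-- Open boxes are open. [folklore] -/
theorem isOpen_openBox (a b : Fin n → ℝ) : IsOpen (openBox a b) := by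
  have : openBox a b = ⋂ i, {x : 𝔼 n | a i < x i ∧ x i < b i} := by ext x; simp [openBox]
  rw [this]
  exact isOpen_iInter_of_finite fun i => (isOpen_lt continuous_const (continuous_coord i)).inter
    (isOpen_lt (continuous_coord i) continuous_const)

/-- Closed boxes are bounded. [folklore] -/
theorem isBounded_box (a b : Fin n → ℝ) : Bornology.IsBounded (box a b) := by
  classical
  -- inside the closed ball of radius `∑ (|a i| + |b i|)` about `0`
  refine (isBounded_closedBall (x := (0 : 𝔼 n)) (r := ∑ i, (|a i| + |b i|))).subset fun x hx => ?_
  rw [mem_closedBall, dist_zero_right, EuclideanSpace.norm_eq]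
  refine (Real.sqrt_le_sqrt (Finset.sum_le_sum (f := fun i => ‖x i‖ ^ 2)
    (g := fun i => (|a i| + |b i|) ^ 2) fun i _ => ?_)).trans ?_
  · have h := hx i
    have : |x i| ≤ |a i| + |b i| :=
      abs_le.2 ⟨by linarith [neg_abs_le (a i), abs_nonneg (b i), h.1], by linarith [le_abs_self (b i), abs_nonneg (a i), h.2]⟩
    rw [Real.norm_eq_abs]
    exact pow_le_pow_left₀ (abs_nonneg _) this 2
  · rw [Real.sqrt_le_left (Finset.sum_nonneg fun i _ => by positivity)]
    exact Finset.sum_sq_le_sq_sum_of_nonneg fun i _ => by positivity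

/-- Closed boxes are compact. [folklore] -/
theorem isCompact_box (a b : Fin n → ℝ) : IsCompact (box a b) :=
  Metric.isCompact_of_isClosed_isBounded (isClosed_box a b) (isBounded_box a b)

/-- The open box lies in the closed box. [folklore] -/
theorem openBox_subset_box (a b : Fin n → ℝ) : openBox a b ⊆ box a b :=
  fun _ hx i => ⟨(hx i).1.le, (hx i).2.le⟩

/-- The open box is contained in the interior of the closed box. [folklore] -/
theorem openBox_subset_interior_box (a b : Fin n → ℝ) : openBox a b ⊆ interior (box a b) :=
  interior_maximal (openBox_subset_box a b) (isOpen_openBox a b)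

/-- Nested boxes with a margin: a closed thickening of a box lies in a bigger box. [folklore] -/
theorem cthickening_box_subset {a b a' b' : Fin n → ℝ} {r : ℝ} (hr : 0 ≤ r)
    (ha : ∀ i, a' i + r ≤ a i) (hb : ∀ i, b i + r ≤ b' i) : cthickening r (box a b) ⊆ box a' b' := by
  intro x hx i
  rw [(isCompact_box a b).cthickening_eq_biUnion_closedBall hr] at hx
  obtain ⟨y, hy, hxy⟩ := mem_iUnion₂.1 hx
  rw [mem_closedBall] at hxy
  have hcoord : |x i - y i| ≤ r := by
    have h1 : |x i - y i| = ‖(x - y) i‖ := by simp [Real.norm_eq_abs]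
    rw [h1]
    exact (PiLp.norm_apply_le (x - y) i).trans (by rwa [← dist_eq_norm])
  have hyi := hy i
  rw [abs_le] at hcoord
  constructor <;> linarith [ha i, hb i]

end Box


/-! ### Part X1: the straight subcomplex and its image -/

namespace BendInput

variable {n N : ℕ} {M : Type*} [TopologicalSpace M] [T2Space M] {I : BendInput n N M}

namespace BendSetup

variable (S : BendSetup I)

/-- The straight simplices: simplices of the trimmed complex inside the zone of `R₂`. [folklore] -/
def Str : Set (Finset (Fin N → ℝ)) :=
  {t | t ∈ S.Kb.faces ∧ convexHull ℝ (t : Set (Fin N → ℝ)) ⊆ zone I.K I.f I.e I.R₂}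

/-- Auxiliary (`str_subset`). [folklore] -/
theorem str_subset : S.Str ⊆ S.Kb.faces := fun _ ht => ht.1

/-- Auxiliary (`str_down`). [folklore] -/
theorem str_down : ∀ t ∈ S.Str, ∀ t' ⊆ t, t'.Nonempty → t' ∈ S.Str := fun _ ht t' htt' hne =>
  ⟨S.Kb.down_closed ht.1 htt' hne, (convexHull_mono (by exact_mod_cast htt')).trans ht.2⟩

/-- The straight subcomplex. [folklore] -/
def StrCx : Geometry.SimplicialComplex ℝ (Fin N → ℝ) := subcomplexOf S.Kb S.Str S.str_subset S.str_down

/-- Auxiliary (`mem_StrCx_faces`). [folklore] -/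
theorem mem_StrCx_faces {t : Finset (Fin N → ℝ)} : t ∈ S.StrCx.faces ↔ t ∈ S.Str := Iff.rfl

/-- Auxiliary (`strCx_finite`). [folklore] -/
theorem strCx_finite : S.StrCx.faces.Finite := S.Kb_finite.subset S.str_subset

/-- Auxiliary (`strCx_space_subset`). [folklore] -/
theorem strCx_space_subset : S.StrCx.space ⊆ S.Kb.space := fun x hx => by
  obtain ⟨t, ht, hxt⟩ := Geometry.SimplicialComplex.mem_space_iff.1 hx
  exact S.Kb.convexHull_subset_space ht.1 hxt

/-- **On the straight part, `e ∘ f' = Λ`.** [folklore] -/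
theorem e_fbend_eq_Λ {x : Fin N → ℝ} (hx : x ∈ S.StrCx.space) :
    S.fbend x ∈ I.e.source ∧ I.e (S.fbend x) = S.Λ x := by
  obtain ⟨t, ht, hxt⟩ := Geometry.SimplicialComplex.mem_space_iff.1 hx
  obtain ⟨hsrc, he, hΛ⟩ := S.straight ht.1.1 ht.2 hxt
  exact ⟨hsrc, by rw [he, hΛ]⟩

/-- **`Λ` is injective on the straight part.** [folklore] -/
theorem injOn_Λ_str : InjOn S.Λ S.StrCx.space := by
  intro x hx y hy hxy
  obtain ⟨hxs, hxe⟩ := S.e_fbend_eq_Λ hx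
  obtain ⟨hys, hye⟩ := S.e_fbend_eq_Λ hy
  rw [← hxe, ← hye] at hxy
  exact S.injOn_fbend (S.strCx_space_subset hx) (S.strCx_space_subset hy) (I.e.injOn hxs hys hxy)

/-- `Λ` is affine on each straight simplex. [folklore] -/
theorem Λ_affine_str : ∀ t ∈ S.StrCx.faces, ∃ A : (Fin N → ℝ) →ᵃ[ℝ] 𝔼 n,
    EqOn S.Λ A (convexHull ℝ (t : Set (Fin N → ℝ))) := fun t ht =>
  ⟨S.A t ht.1.1, S.Λ_eqOn ht.1.1⟩

/-- **The image complex `Q` of the straight part under `Λ`** (faces = images of straight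
simplices; closed simplices = images of closed simplices). [folklore] -/
theorem exists_Q : ∃ Q : Geometry.SimplicialComplex ℝ (𝔼 n),
    (∀ r, r ∈ Q.faces ↔ ∃ t ∈ S.Str, t.image S.Λ = r) ∧
    ∀ t ∈ S.Str, convexHull ℝ ((t.image S.Λ : Finset (𝔼 n)) : Set (𝔼 n)) =
      S.Λ '' convexHull ℝ (t : Set (Fin N → ℝ)) := by
  classical
  exact exists_simplicialComplex_image S.StrCx S.Λ S.Λ_affine_str S.injOn_Λ_str

/-- The image complex of the straight part. [folklore] -/
def Q : Geometry.SimplicialComplex ℝ (𝔼 n) := S.exists_Q.choose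

/-- Auxiliary (`mem_Q_faces`). [folklore] -/
theorem mem_Q_faces {r : Finset (𝔼 n)} : r ∈ S.Q.faces ↔ ∃ t ∈ S.Str, t.image S.Λ = r :=
  S.exists_Q.choose_spec.1 r

/-- Auxiliary (`Q_hull`). [folklore] -/
theorem Q_hull {t : Finset (Fin N → ℝ)} (ht : t ∈ S.Str) :
    convexHull ℝ ((t.image S.Λ : Finset (𝔼 n)) : Set (𝔼 n)) = S.Λ '' convexHull ℝ (t : Set (Fin N → ℝ)) :=
  S.exists_Q.choose_spec.2 t ht

/-- Auxiliary (`Q_finite`). [folklore] -/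
theorem Q_finite : S.Q.faces.Finite := by
  classical
  have : S.Q.faces ⊆ (fun t => t.image S.Λ) '' S.Str := fun r hr => by
    obtain ⟨t, ht, rfl⟩ := S.mem_Q_faces.1 hr
    exact ⟨t, ht, rfl⟩
  exact (S.strCx_finite.image _).subset this

/-- The image map is injective on straight simplices (as finsets). [folklore] -/
theorem image_Λ_injOn : InjOn (fun t : Finset (Fin N → ℝ) => t.image S.Λ) S.Str := by
  classical
  intro t ht t' ht' h
  have hv : ∀ {u : Finset (Fin N → ℝ)}, u ∈ S.Str → ∀ v ∈ u, v ∈ S.StrCx.space := fun hu v hv =>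
    S.StrCx.convexHull_subset_space hu (subset_convexHull ℝ _ hv)
  ext v
  constructor
  · intro hvt
    have h1 : S.Λ v ∈ t'.image S.Λ := by
      have : S.Λ v ∈ t.image S.Λ := Finset.mem_image_of_mem _ hvt
      simpa only [h] using this
    obtain ⟨v', hv', hvv'⟩ := Finset.mem_image.1 h1
    rwa [← S.injOn_Λ_str (hv ht' v' hv') (hv ht v hvt) hvv']
  · intro hvt'
    have h1 : S.Λ v ∈ t.image S.Λ := by
      have : S.Λ v ∈ t'.image S.Λ := Finset.mem_image_of_mem _ hvt'
      simpa only [← h] using this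
    obtain ⟨v', hv', hvv'⟩ := Finset.mem_image.1 h1
    rwa [← S.injOn_Λ_str (hv ht v' hv') (hv ht' v hvt') hvv']

/-- **Simplices of `K''` meeting the zone of `R₁` are straight.** [folklore] -/
theorem str_of_meets₁ {t : Finset (Fin N → ℝ)} (ht : t ∈ S.Kb.faces)
    (hmeet : (convexHull ℝ (t : Set (Fin N → ℝ)) ∩ zone I.K I.f I.e I.R₁).Nonempty) : t ∈ S.Str :=
  ⟨ht, S.subset_zone₂_of_meets₁ ht.1 hmeet⟩

open Classical in
/-- The image simplex `Λ(t)` as a finset of the chart space. [folklore] -/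
def rIm (t : Finset (Fin N → ℝ)) : Finset (𝔼 n) := t.image S.Λ

/-- Vertices of straight simplices lie in the straight part. [folklore] -/
theorem mem_strCx_space_of_mem {t : Finset (Fin N → ℝ)} (ht : t ∈ S.Str) {v : Fin N → ℝ} (hv : v ∈ t) :
    v ∈ S.StrCx.space := S.StrCx.convexHull_subset_space ht (subset_convexHull ℝ _ hv)

/-- `Λ` is injective on the vertices of a straight simplex. [folklore] -/
theorem injOn_Λ_of_str {t : Finset (Fin N → ℝ)} (ht : t ∈ S.Str) : InjOn S.Λ (t : Set (Fin N → ℝ)) :=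
  S.injOn_Λ_str.mono fun _ hv => S.mem_strCx_space_of_mem ht hv

/-- Auxiliary (`card_rIm`). [folklore] -/
theorem card_rIm {t : Finset (Fin N → ℝ)} (ht : t ∈ S.Str) : (S.rIm t).card = t.card := by
  classical
  unfold rIm
  convert Finset.card_image_of_injOn (S.injOn_Λ_of_str ht)

/-- Auxiliary (`coe_rIm`). [folklore] -/
theorem coe_rIm (t : Finset (Fin N → ℝ)) : ((S.rIm t : Finset (𝔼 n)) : Set (𝔼 n)) = S.Λ '' (t : Set (Fin N → ℝ)) := by
  classical
  unfold rIm
  convert Finset.coe_image (f := S.Λ) (s := t)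

/-- The image simplex of a straight simplex is affinely independent. [folklore] -/
theorem affineIndependent_rIm {t : Finset (Fin N → ℝ)} (ht : t ∈ S.Str) :
    AffineIndependent ℝ ((↑) : ↥(S.rIm t) → 𝔼 n) := by
  classical
  have hinj : InjOn (S.A t ht.1.1) (convexHull ℝ (t : Set (Fin N → ℝ))) := by
    intro x hx y hy hxy
    rw [← S.Λ_eqOn ht.1.1 hx, ← S.Λ_eqOn ht.1.1 hy] at hxy
    exact S.injOn_Λ_str (S.StrCx.convexHull_subset_space ht hx) (S.StrCx.convexHull_subset_space ht hy) hxy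
  have h := affineIndependent_image_of_injOn (S.Kb.indep ht.1) (S.A t ht.1.1) hinj
  have heq : t.image (S.A t ht.1.1) = S.rIm t := by
    unfold rIm
    convert Finset.image_congr (f := (S.A t ht.1.1 : (Fin N → ℝ) → 𝔼 n)) (g := S.Λ) fun v hv =>
      (S.Λ_eqOn ht.1.1 (subset_convexHull ℝ _ (Finset.mem_coe.1 hv))).symm using 2
  rw [heq] at h
  exact h

/-- The closed image simplex is the image of the closed simplex. [folklore] -/
theorem convexHull_rIm {t : Finset (Fin N → ℝ)} (ht : t ∈ S.Str) :
    convexHull ℝ ((S.rIm t : Finset (𝔼 n)) : Set (𝔼 n)) = S.Λ '' convexHull ℝ (t : Set (Fin N → ℝ)) := by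
  classical
  unfold rIm
  convert S.Q_hull ht using 3

/-! ### Boxes of the extension step -/

/-- **Input of the extension step**: the inner box `R₀ = [a₀, b₀]` and the outer box
`R₀⁺ = [aP, bP]` of the chart space, strictly nested, with `cthickening (2 εreq) R₀⁺ ⊆ R₁`.
(Bookkeeping structure, not a named fact.) [cite: Munkres1966, Lemma 10.4] -/
structure ExtInput (S : BendSetup I) where
  /-- inner box corners -/
  a₀ : Fin n → ℝ
  b₀ : Fin n → ℝ
  /-- outer box corners -/
  aP : Fin n → ℝ
  bP : Fin n → ℝ
  hbox : ∀ i, aP i < a₀ i ∧ a₀ i < b₀ i ∧ b₀ i < bP i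
  hmargin : cthickening (2 * I.εreq) (box aP bP) ⊆ I.R₁

variable {S} (X : ExtInput S)

namespace ExtInput

/-- The inner box. [folklore] -/
def R₀ : Set (𝔼 n) := box X.a₀ X.b₀

/-- The outer box. [folklore] -/
def RP : Set (𝔼 n) := box X.aP X.bP

/-- Auxiliary (`R₀_subset_openBox`). [folklore] -/
theorem R₀_subset_openBox : X.R₀ ⊆ openBox X.aP X.bP := fun _ hx i =>
  ⟨(X.hbox i).1.trans_le (hx i).1, (hx i).2.trans_lt (X.hbox i).2.2⟩

/-- Auxiliary (`R₀_subset_RP`). [folklore] -/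
theorem R₀_subset_RP : X.R₀ ⊆ X.RP := X.R₀_subset_openBox.trans (openBox_subset_box _ _)

/-- Auxiliary (`RP_subset_R₁`). [folklore] -/
theorem RP_subset_R₁ : X.RP ⊆ I.R₁ := (self_subset_cthickening _).trans X.hmargin

/-- Auxiliary (`isCompact_R₀`). [folklore] -/
theorem isCompact_R₀ : IsCompact X.R₀ := isCompact_box _ _

/-- Auxiliary (`isCompact_RP`). [folklore] -/
theorem isCompact_RP : IsCompact X.RP := isCompact_box _ _

/-- **Points of `K''` whose bent image lands `εreq`-near the outer box lie in the zone of `R₁`.**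
[folklore] -/
theorem mem_zone₁_of_fbend {x : Fin N → ℝ} (hxK : x ∈ S.Kb.space) (hsrc : S.fbend x ∈ I.e.source)
    (hx : I.e (S.fbend x) ∈ cthickening I.εreq X.RP) : x ∈ zone I.K I.f I.e I.R₁ := by
  have hxD : x ∈ I.D := by
    by_contra h
    rw [S.fbend_of_notMem h] at hsrc
    exact h ⟨S.Kb_space_subset hxK, hsrc⟩
  rw [I.mem_zone_iff_F I.R₁t]
  refine ⟨hxD, X.hmargin ?_⟩
  have h1 : I.F x ∈ cthickening I.εreq (cthickening I.εreq X.RP) := by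
    refine mem_cthickening_of_dist_le _ _ _ _ hx ?_
    rw [dist_comm, dist_eq_norm]
    exact (S.norm_e_fbend_sub_le hxD).trans S.δ₀_le_εreq
  have h2 := cthickening_cthickening_subset I.hεreq.le I.hεreq.le X.RP h1
  rwa [show I.εreq + I.εreq = 2 * I.εreq by ring] at h2

/-- The top straight simplices whose images meet the outer box. [folklore] -/
def T₁ : Set (Finset (Fin N → ℝ)) :=
  {t | t ∈ S.Str ∧ t.card = n + 1 ∧ (S.Λ '' convexHull ℝ (t : Set (Fin N → ℝ)) ∩ X.RP).Nonempty}

/-- Auxiliary (`t₁_finite`). [folklore] -/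
theorem t₁_finite : X.T₁.Finite := S.strCx_finite.subset fun _ ht => ht.1

/-- Auxiliary (`t₁_subset_str`). [folklore] -/
theorem t₁_subset_str : X.T₁ ⊆ S.Str := fun _ ht => ht.1

/-- **Simplices of `T₁` lie in the zone of `R₁`** (pointwise). [folklore] -/
theorem subset_zone₁_of_mem_T₁ {t : Finset (Fin N → ℝ)} (ht : t ∈ X.T₁) :
    convexHull ℝ (t : Set (Fin N → ℝ)) ⊆ zone I.K I.f I.e I.R₁ := by
  obtain ⟨⟨htK, ht2⟩, -, ⟨_, ⟨x₀, hx₀, rfl⟩, hx₀P⟩⟩ := ht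
  intro y hy
  have hx₀D : x₀ ∈ I.D := I.zone_subset_D I.R₂t (ht2 hx₀)
  have hyD : y ∈ I.D := I.zone_subset_D I.R₂t (ht2 hy)
  have hx₀4 : x₀ ∈ zone I.K I.f I.e I.R₄ := zone_mono I.R₂_subset_R₄ (ht2 hx₀)
  -- `F y` is within `η₀` of `F x₀`, which is within `δ₀` of `Λ x₀ ∈ R₀⁺`
  have hd1 : dist (I.F y) (I.F x₀) ≤ S.η₀ :=
    (S.hτb' x₀ hx₀4 y hyD.1 (S.dist_le_tau_of_mem_P htK.1 hy hx₀)).2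
  obtain ⟨-, he, hΛ⟩ := S.straight htK.1 ht2 hx₀
  have hd2 : dist (I.F x₀) (S.Λ x₀) ≤ S.δ₀ := by
    rw [hΛ, ← he, dist_comm, dist_eq_norm]
    exact S.norm_e_fbend_sub_le hx₀D
  rw [I.mem_zone_iff_F I.R₁t]
  refine ⟨hyD, X.hmargin (mem_cthickening_of_dist_le _ (S.Λ x₀) _ _ hx₀P ?_)⟩
  calc dist (I.F y) (S.Λ x₀) ≤ dist (I.F y) (I.F x₀) + dist (I.F x₀) (S.Λ x₀) := dist_triangle _ _ _
    _ ≤ S.η₀ + S.δ₀ := add_le_add hd1 hd2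
    _ ≤ 2 * I.εreq := by linarith [S.η₀_le_εreq, S.δ₀_le_εreq, I.hεreq]

/-- **A simplex of `K''` sharing a vertex with a simplex of `T₁` is straight.** [folklore] -/
theorem str_of_inter_T₁ {u t : Finset (Fin N → ℝ)} (hu : u ∈ S.Kb.faces) (ht : t ∈ X.T₁)
    (hv : (u ∩ t).Nonempty) : u ∈ S.Str := by
  obtain ⟨v, hv⟩ := hv
  rw [Finset.mem_inter] at hv
  exact S.str_of_meets₁ hu ⟨v, subset_convexHull ℝ _ hv.1,
    X.subset_zone₁_of_mem_T₁ ht (subset_convexHull ℝ _ hv.2)⟩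

/-- **A straight simplex whose image meets the outer box is a face of a simplex of `T₁`.**
[folklore] -/
theorem exists_T₁_of_meets {u : Finset (Fin N → ℝ)} (hu : u ∈ S.Str)
    (hmeet : (S.Λ '' convexHull ℝ (u : Set (Fin N → ℝ)) ∩ X.RP).Nonempty) : ∃ t ∈ X.T₁, u ⊆ t := by
  obtain ⟨t, ht, hut, hcard⟩ := S.Kb_pure hu.1
  obtain ⟨_, ⟨x, hx, rfl⟩, hxP⟩ := hmeet
  have hxt : x ∈ convexHull ℝ (t : Set (Fin N → ℝ)) := convexHull_mono (by exact_mod_cast hut) hx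
  obtain ⟨hsrc, he, hΛ⟩ := S.straight hu.1.1 hu.2 hx
  have hx1 : x ∈ zone I.K I.f I.e I.R₁ := by
    refine X.mem_zone₁_of_fbend (S.Kb.convexHull_subset_space hu.1 hx) hsrc ?_
    rw [he, ← hΛ]
    exact self_subset_cthickening _ hxP
  have htstr : t ∈ S.Str := S.str_of_meets₁ ht ⟨x, hxt, hx1⟩
  exact ⟨t, ⟨htstr, hcard, S.Λ x, ⟨x, hxt, rfl⟩, hxP⟩, hut⟩

/-- Straight simplices not contained in a simplex of `T₁` have image disjoint from the outer box.
[folklore] -/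
theorem disjoint_RP_of_forall_not_subset {u : Finset (Fin N → ℝ)} (hu : u ∈ S.Str)
    (h : ∀ t ∈ X.T₁, ¬u ⊆ t) : Disjoint (S.Λ '' convexHull ℝ (u : Set (Fin N → ℝ))) X.RP := by
  rw [Set.disjoint_iff_inter_eq_empty]
  by_contra hne
  obtain ⟨t, ht, hut⟩ := X.exists_T₁_of_meets hu (nonempty_iff_ne_empty.2 hne)
  exact h t ht hut

/-! ### Part X2: the arrangement and its cell complex -/

/-- The finite set of simplices `T₁`. [folklore] -/
def T₁f : Finset (Finset (Fin N → ℝ)) := X.t₁_finite.toFinset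

/-- Auxiliary (`mem_T₁f`). [folklore] -/
theorem mem_T₁f {t : Finset (Fin N → ℝ)} : t ∈ X.T₁f ↔ t ∈ X.T₁ := X.t₁_finite.mem_toFinset

/-- **The affine basis of the image of a simplex of `T₁`.** [folklore] -/
def β (t : ↥X.T₁f) : AffineBasis ↥(S.rIm (t : Finset (Fin N → ℝ))) ℝ (𝔼 n) where
  toFun := (↑)
  ind' := S.affineIndependent_rIm (X.t₁_subset_str (X.mem_T₁f.1 t.2))
  tot' := by
    have ht : (t : Finset (Fin N → ℝ)) ∈ X.T₁ := X.mem_T₁f.1 t.2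
    rw [(S.affineIndependent_rIm (X.t₁_subset_str ht)).affineSpan_eq_top_iff_card_eq_finrank_add_one,
      Fintype.card_coe, S.card_rIm (X.t₁_subset_str ht), ht.2.1, finrank_euclideanSpace_fin]

/-- Auxiliary (`β_apply`). [folklore] -/
theorem β_apply (t : ↥X.T₁f) (v : ↥(S.rIm (t : Finset (Fin N → ℝ)))) : X.β t v = (v : 𝔼 n) := rfl

/-- Auxiliary (`range_β`). [folklore] -/
theorem range_β (t : ↥X.T₁f) : Set.range (X.β t) = ((S.rIm (t : Finset (Fin N → ℝ)) : Finset (𝔼 n)) : Set (𝔼 n)) :=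
  Set.ext fun y => ⟨fun ⟨v, hv⟩ => hv ▸ v.2, fun hy => ⟨⟨y, hy⟩, rfl⟩⟩

/-- The index type of the arrangement: box facets and barycentric coordinates. [folklore] -/
abbrev Idx : Type := (Fin n ⊕ Fin n) ⊕ (Σ t : ↥X.T₁f, ↥(S.rIm (t : Finset (Fin N → ℝ))))

/-- The `i`-th coordinate as an affine functional. [folklore] -/
def coordAff (i : Fin n) : 𝔼 n →ᵃ[ℝ] ℝ :=
  ((EuclideanSpace.proj i : 𝔼 n →L[ℝ] ℝ) : 𝔼 n →ₗ[ℝ] ℝ).toAffineMap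

/-- Auxiliary (`coordAff_apply`). [folklore] -/
theorem coordAff_apply (i : Fin n) (x : 𝔼 n) : coordAff i x = x i := rfl

/-- **The functionals of the arrangement.** [folklore] -/
def L : X.Idx → 𝔼 n →ᵃ[ℝ] ℝ
  | Sum.inl (Sum.inl i) => coordAff i + AffineMap.const ℝ (𝔼 n) (-(X.a₀ i))
  | Sum.inl (Sum.inr i) => AffineMap.const ℝ (𝔼 n) (X.b₀ i) - coordAff i
  | Sum.inr ⟨t, v⟩ => (X.β t).coord v

/-- Auxiliary (`L_lower_apply`). [folklore] -/
theorem L_lower_apply (i : Fin n) (x : 𝔼 n) : X.L (Sum.inl (Sum.inl i)) x = x i - X.a₀ i := by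
  simp [L, coordAff_apply, sub_eq_add_neg]

/-- Auxiliary (`L_upper_apply`). [folklore] -/
theorem L_upper_apply (i : Fin n) (x : 𝔼 n) : X.L (Sum.inl (Sum.inr i)) x = X.b₀ i - x i := by
  simp [L, coordAff_apply]

/-- Auxiliary (`L_coord`). [folklore] -/
theorem L_coord (t : ↥X.T₁f) (v : ↥(S.rIm (t : Finset (Fin N → ℝ)))) : X.L (Sum.inr ⟨t, v⟩) = (X.β t).coord v := rfl

/-- **The inner box is a cell.** [folklore] -/
theorem R₀_eq_cellSet : X.R₀ = cellSet X.L (Set.range (Sum.inl : Fin n ⊕ Fin n → X.Idx)) ∅ := by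
  ext x
  rw [mem_cellSet_iff]
  simp only [mem_empty_iff_false, IsEmpty.forall_iff, implies_true, and_true, mem_range,
    forall_exists_index, forall_apply_eq_imp_iff]
  constructor
  · intro hx j
    rcases j with i | i
    · rw [L_lower_apply]; linarith [(hx i).1]
    · rw [L_upper_apply]; linarith [(hx i).2]
  · intro h i
    have h1 := h (Sum.inl i)
    have h2 := h (Sum.inr i)
    rw [L_lower_apply] at h1
    rw [L_upper_apply] at h2
    exact ⟨by linarith, by linarith⟩

/-- The coordinate index map of a simplex of `T₁`. [folklore] -/
def eIdx (t : ↥X.T₁f) : ↥(S.rIm (t : Finset (Fin N → ℝ))) → X.Idx := fun v => Sum.inr ⟨t, v⟩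

/-- **Faces of the image simplices are cells.** [folklore] -/
theorem convexHull_image_β_eq_cellSet (t : ↥X.T₁f) (Sv : Set ↥(S.rIm (t : Finset (Fin N → ℝ)))) :
    convexHull ℝ (X.β t '' Sv) = cellSet X.L (Set.range (X.eIdx t)) (X.eIdx t '' Svᶜ) :=
  convexHull_image_eq_cellSet (X.β t) (X.eIdx t) (fun _ => rfl) Sv

/-- **The image simplices are cells.** [folklore] -/
theorem convexHull_rIm_eq_cellSet (t : ↥X.T₁f) :
    convexHull ℝ ((S.rIm (t : Finset (Fin N → ℝ)) : Finset (𝔼 n)) : Set (𝔼 n)) =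
      cellSet X.L (Set.range (X.eIdx t)) ∅ := by
  have h := X.convexHull_image_β_eq_cellSet t Set.univ
  rwa [image_univ, range_β, compl_univ, image_empty] at h

/-- The cells of the arrangement: the inner box and the image simplices. [folklore] -/
def J : Option ↥X.T₁f → Set X.Idx
  | none => Set.range (Sum.inl : Fin n ⊕ Fin n → X.Idx)
  | some t => Set.range (X.eIdx t)

/-- Auxiliary (`cellSet_J_none`). [folklore] -/
theorem cellSet_J_none : cellSet X.L (X.J none) ∅ = X.R₀ := X.R₀_eq_cellSet.symm

/-- Auxiliary (`cellSet_J_some`). [folklore] -/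
theorem cellSet_J_some (t : ↥X.T₁f) :
    cellSet X.L (X.J (some t)) ∅ = S.Λ '' convexHull ℝ ((t : Finset (Fin N → ℝ)) : Set (Fin N → ℝ)) := by
  show cellSet X.L (Set.range (X.eIdx t)) ∅ = _
  rw [← X.convexHull_rIm_eq_cellSet t, S.convexHull_rIm (X.t₁_subset_str (X.mem_T₁f.1 t.2))]

/-- The cells are bounded. [folklore] -/
theorem isBounded_cells : ∀ o : Option ↥X.T₁f, Bornology.IsBounded (cellSet X.L (X.J o) ((fun _ => ∅) o)) := by
  rintro (_ | t)
  · show Bornology.IsBounded (cellSet X.L (X.J none) ∅)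
    rw [cellSet_J_none]; exact isBounded_box _ _
  · show Bornology.IsBounded (cellSet X.L (Set.range (X.eIdx t)) ∅)
    rw [← X.convexHull_rIm_eq_cellSet t]
    exact ((Finset.finite_toSet _).isCompact_convexHull ℝ).isBounded

/-- **The cell complex `Ph` of the arrangement** (Munkres' `L`, triangulated): existence with its
six properties. [folklore] -/
theorem exists_Ph : ∃ P : Geometry.SimplicialComplex ℝ (𝔼 n), P.faces.Finite ∧
      (∀ o, cellSet X.L (X.J o) ∅ ⊆ P.space) ∧
      (∀ τ ∈ P.faces, ∃ o, convexHull ℝ (τ : Set (𝔼 n)) ⊆ cellSet X.L (X.J o) ∅) ∧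
      (∀ x, (∃ o, x ∈ cellSet X.L (X.J o) ∅) → ∀ J' Z' : Set X.Idx, x ∈ cellSet X.L J' Z' →
        ∃ τ ∈ P.faces, x ∈ convexHull ℝ (τ : Set (𝔼 n)) ∧ convexHull ℝ (τ : Set (𝔼 n)) ⊆ cellSet X.L J' Z') ∧
      (∀ p, (∃ o, p ∈ cellSet X.L (X.J o) ∅) → face X.L (svec X.L p) = {p} →
        ∀ τ ∈ P.faces, p ∈ convexHull ℝ (τ : Set (𝔼 n)) → p ∈ τ) ∧
      (∀ τ ∈ P.faces, ∀ p ∈ τ, ∀ q ∈ τ, face X.L (svec X.L p) = {p} → face X.L (svec X.L q) = {q} → p = q) := by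
  classical
  exact exists_cellComplex₂ X.L X.J (fun _ => ∅) X.isBounded_cells

/-- The cell complex of the arrangement. [folklore] -/
def Ph : Geometry.SimplicialComplex ℝ (𝔼 n) := X.exists_Ph.choose

/-- Auxiliary (`Ph_finite`). [folklore] -/
theorem Ph_finite : X.Ph.faces.Finite := X.exists_Ph.choose_spec.1

/-- `Ph` covers the inner box. [folklore] -/
theorem R₀_subset_Ph_space : X.R₀ ⊆ X.Ph.space := by
  rw [← cellSet_J_none]; exact X.exists_Ph.choose_spec.2.1 none

/-- `Ph` covers the image simplices of `T₁`. [folklore] -/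
theorem image_subset_Ph_space {t : Finset (Fin N → ℝ)} (ht : t ∈ X.T₁) :
    S.Λ '' convexHull ℝ (t : Set (Fin N → ℝ)) ⊆ X.Ph.space := by
  have h := X.exists_Ph.choose_spec.2.1 (some ⟨t, X.mem_T₁f.2 ht⟩)
  rwa [cellSet_J_some] at h

/-- **Each simplex of `Ph` lies in the inner box or in a single image simplex of `T₁`.** [folklore] -/
theorem Ph_inside {τ : Finset (𝔼 n)} (hτ : τ ∈ X.Ph.faces) :
    convexHull ℝ (τ : Set (𝔼 n)) ⊆ X.R₀ ∨
      ∃ t ∈ X.T₁, convexHull ℝ (τ : Set (𝔼 n)) ⊆ S.Λ '' convexHull ℝ (t : Set (Fin N → ℝ)) := by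
  obtain ⟨o, ho⟩ := X.exists_Ph.choose_spec.2.2.1 τ hτ
  rcases o with _ | t
  · left; rwa [cellSet_J_none] at ho
  · right
    rw [cellSet_J_some] at ho
    exact ⟨t, X.mem_T₁f.1 t.2, ho⟩

/-- **`Ph` refines the faces of the image simplices simplexwise.** [folklore] -/
theorem Ph_refines {t : Finset (Fin N → ℝ)} (ht : t ∈ X.T₁) {σ : Finset (Fin N → ℝ)} (hσt : σ ⊆ t)
    {y : 𝔼 n} (hy : y ∈ S.Λ '' convexHull ℝ (σ : Set (Fin N → ℝ))) :
    ∃ τ ∈ X.Ph.faces, y ∈ convexHull ℝ (τ : Set (𝔼 n)) ∧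
      convexHull ℝ (τ : Set (𝔼 n)) ⊆ S.Λ '' convexHull ℝ (σ : Set (Fin N → ℝ)) := by
  classical
  set t' : ↥X.T₁f := ⟨t, X.mem_T₁f.2 ht⟩ with ht'
  have htstr : t ∈ S.Str := X.t₁_subset_str ht
  -- the face `Λ '' conv σ` as a cell
  set Sv : Set ↥(S.rIm t) := {v | (v : 𝔼 n) ∈ S.Λ '' (σ : Set (Fin N → ℝ))} with hSv
  have hface : S.Λ '' convexHull ℝ (σ : Set (Fin N → ℝ)) = convexHull ℝ (X.β t' '' Sv) := by
    have hσstr : σ.Nonempty → σ ∈ S.Str := fun hne => S.str_down t htstr σ hσt hne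
    rcases σ.eq_empty_or_nonempty with rfl | hne
    · have : Sv = ∅ := by
        ext v; simp [hSv]
      simp [this]
    · rw [← S.Q_hull (hσstr hne)]
      congr 1
      ext z
      simp only [Finset.coe_image, mem_image, Finset.mem_coe, hSv]
      constructor
      · rintro ⟨v, hv, rfl⟩
        have hvr : S.Λ v ∈ S.rIm t := by
          unfold rIm; exact Finset.mem_image_of_mem _ (hσt hv)
        exact ⟨⟨S.Λ v, hvr⟩, ⟨v, hv, rfl⟩, rfl⟩
      · rintro ⟨⟨z', hz'⟩, ⟨v, hv, hvz⟩, rfl⟩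
        exact ⟨v, hv, hvz⟩
  have hy' : y ∈ cellSet X.L (Set.range (X.eIdx t')) (X.eIdx t' '' Svᶜ) := by
    rw [← X.convexHull_image_β_eq_cellSet t' Sv, ← hface]; exact hy
  have hyo : ∃ o, y ∈ cellSet X.L (X.J o) ∅ :=
    ⟨some t', by rw [cellSet_J_some]; exact (image_mono (convexHull_mono (by exact_mod_cast hσt))) hy⟩
  obtain ⟨τ, hτ, hyτ, hsub⟩ := X.exists_Ph.choose_spec.2.2.2.1 y hyo _ _ hy'
  refine ⟨τ, hτ, hyτ, ?_⟩
  rw [hface, X.convexHull_image_β_eq_cellSet t' Sv]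
  exact hsub

/-- **Vertices `Λ v` of the image simplices of `T₁` are vertices of every simplex of `Ph`
containing them.** [folklore] -/
theorem Ph_vertex {t : Finset (Fin N → ℝ)} (ht : t ∈ X.T₁) {v : Fin N → ℝ} (hv : v ∈ t)
    {τ : Finset (𝔼 n)} (hτ : τ ∈ X.Ph.faces) (hmem : S.Λ v ∈ convexHull ℝ (τ : Set (𝔼 n))) : S.Λ v ∈ τ := by
  classical
  set t' : ↥X.T₁f := ⟨t, X.mem_T₁f.2 ht⟩ with ht'
  have hvr : S.Λ v ∈ S.rIm t := by unfold rIm; exact Finset.mem_image_of_mem _ hv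
  have hface : face X.L (svec X.L (S.Λ v)) = {S.Λ v} := by
    exact face_svec_eq_singleton (X.β t') (L := X.L) (X.eIdx t') (fun _ => rfl) ⟨S.Λ v, hvr⟩
  have ho : ∃ o, S.Λ v ∈ cellSet X.L (X.J o) ∅ :=
    ⟨some t', by rw [cellSet_J_some]; exact ⟨v, subset_convexHull ℝ _ hv, rfl⟩⟩
  exact X.exists_Ph.choose_spec.2.2.2.2.1 _ ho hface τ hτ hmem

/-- The face of the arrangement at a vertex `Λ v` of an image simplex of `T₁` is a singleton.
[folklore] -/
theorem face_Λ_eq_singleton {t : Finset (Fin N → ℝ)} (ht : t ∈ X.T₁) {v : Fin N → ℝ} (hv : v ∈ t) :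
    face X.L (svec X.L (S.Λ v)) = {S.Λ v} := by
  classical
  set t' : ↥X.T₁f := ⟨t, X.mem_T₁f.2 ht⟩ with ht'
  have hvr : S.Λ v ∈ S.rIm t := by unfold rIm; exact Finset.mem_image_of_mem _ hv
  exact face_svec_eq_singleton (X.β t') (L := X.L) (X.eIdx t') (fun _ => rfl) ⟨S.Λ v, hvr⟩

/-- **A simplex of `Ph` has at most one vertex of the form `Λ v` with `v` a vertex of a simplex
of `T₁`.** [folklore] -/
theorem Ph_vertex_unique {τ : Finset (𝔼 n)} (hτ : τ ∈ X.Ph.faces) {t₁ t₂ : Finset (Fin N → ℝ)}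
    (ht₁ : t₁ ∈ X.T₁) (ht₂ : t₂ ∈ X.T₁) {v₁ v₂ : Fin N → ℝ} (hv₁ : v₁ ∈ t₁) (hv₂ : v₂ ∈ t₂)
    (h₁ : S.Λ v₁ ∈ τ) (h₂ : S.Λ v₂ ∈ τ) : S.Λ v₁ = S.Λ v₂ :=
  X.exists_Ph.choose_spec.2.2.2.2.2 τ hτ _ h₁ _ h₂ (X.face_Λ_eq_singleton ht₁ hv₁) (X.face_Λ_eq_singleton ht₂ hv₂)

end ExtInput

end BendSetup

end BendInput


end Literature.Topology.FourManifolds
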